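import Literature.NumberTheory.DiophantineGeometry.GenEllMechanismAssemblyPlaces
import Literature.NumberTheory.DiophantineGeometry.GenEllMechanismFor
import Literature.NumberTheory.DiophantineGeometry.GenEllMechanismKappa
import Mathlib.FieldTheory.SplittingField.Construction
import Mathlib.NumberTheory.NumberField.Basic
import HarnessLib

/-!
# [GenEll] Thm 2.1 for `ℙ¹` at an ARBITRARY finite set of primes `Σ` (W-Σ, piece 2): the mechanism
# of a configuration, with separation at `{∞} ∪ S` — the `hmech` body of the PLACES spine

S. Mochizuki, *Arithmetic elliptic curves in general position*, Math. J. Okayama Univ. **52** (2010),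
Thm. 2.1 (ii) ⇒ (i), proof pp. 12–13 [cite: MochizukiGenEll2010, Thm 2.1 p.12] — "Let `Σ` be a
finite set of prime numbers" (p. 11); "`V ⊆ V(ℚ)` … contains `V(ℚ)^{arc}` and `Σ`" (p. 12).

`Σ`-generic TWIN of w5-d075's `mechanismFor_of_kappa` (route item `GenEllTwo`, `Σ = {2}`), for the
named fact `GenEll_thm21_primes` (F-1336), with the W5 conductor bound DISCHARGED by w5-d045's landed
`GenEll.exists_condBound_mechanism` (p421189).  For a finite set of primes `S ∋ 2` with statement
(ii) at `Σ = S`, a degree `d`, `ε > 0`, `k ≥ 3` with `(2k+1)/(2k−2) < 1+ε`, a parameter `c ≠ 0` of the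
family `t_c` and a polynomial `Pers` vanishing on the persistent set of `c` in every field of
characteristic `0` (d065), it produces: for every configuration polynomial `q ≠ 0` coprime to `Pers`
a bad polynomial `g` coprime to `q` such that Vojta's inequality holds in degree `≤ d`, for every
`r > 0`, on the points ALL of whose conjugates at `∞` AND AT EVERY `ℓ ∈ S` are `r`-far from the roots
of `g` — the `hmech` binder of the multi-place spine
`GenEllConjugateAvoidancePlaces.vojtaIneq_univ_of_persistent_places` (after the `Λ ↔ S` transport of
piece 3).  The 2-adic separation clause of the conductor bound is available because `2 ∈ S`
(WLOG: statement (ii) is antitone in `Σ`).  Steps and inputs exactly as at `{2}`: pole polynomial of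
`q` (`ConfigurationProtection.exists_polePoly`) avoiding the critical values
(`aeval_polePoly_ne_zero_of_mem_critSetC`), S7's noncritical Belyi map
(`NoncriticalBelyi.exists_p1FiniteMap_noncritical_protect`), coprimality of the bad resultant with
`q`, `ε'` from `exists_eps_of_margin`, the integral primitive polynomial `μ`
(`exists_monic_int_splits`), the fixed-layer different (w5-d036 `exists_logDiff_adjoin_root_le`),
piece 1 `vojtaIneq_mechanism_of_condBound_places`, and — new here — the field
`K := SplittingField (R_c · f g (f−g))` feeding `exists_condBound_mechanism`.

* `mechanismFor_places`.

Theorems only; classical; nothing here bears on [IUTchIII] Cor. 3.12.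
-/

noncomputable section

open Polynomial NumberField

namespace Literature.NumberTheory.DiophantineGeometry.GenEll

/-- **The mechanism of a configuration with separation at `{∞} ∪ S`** (`S ∋ 2` a finite set of
primes, statement (ii) at `Σ = S`): for every configuration polynomial `q ≠ 0` coprime to the
persistent polynomial `Pers` of the parameter `c ≠ 0` there is `g ∈ ℚ[X]` coprime to `q` such that,
for every `r > 0`, Vojta's inequality `ht ≲ (1+ε)(log-diff + log-cond)` holds in degree `≤ d` on the
points all of whose conjugates at `∞` and at every `ℓ ∈ S` are `r`-far from the roots of `g`.  (The
`Σ`-generic twin of `mechanismFor_of_kappa`, conductor bound discharged by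
`exists_condBound_mechanism`.) [cite: MochizukiGenEll2010, Thm 2.1 proof pp.12–13] -/
theorem mechanismFor_places {S : Finset ℕ} (hS : ∀ ℓ ∈ S, ℓ.Prime) (h2S : 2 ∈ S)
    (hii : ABCCompactlyBounded S) {d : ℕ} (hd : 0 < d) {ε : ℝ} (hε : 0 < ε) {k : ℕ} (hk : 3 ≤ k)
    (hke : ((2 * k + 1 : ℕ) : ℝ) / (((2 * k + 1 : ℕ) : ℝ) - 3) < 1 + ε)
    {c : ℚ} (hc0 : c ≠ 0) {Pers : ℚ[X]}
    (hroots : ∀ (Ω : Type) [Field Ω] [CharZero Ω],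
      ∀ a ∈ DeFamily.persistentSet k (c : Ω), aeval a Pers = 0) :
    ∀ q : ℚ[X], q ≠ 0 → IsCoprime q Pers → ∃ g : ℚ[X], IsCoprime g q ∧ ∀ r : ℝ, 0 < r →
      VojtaIneq {P : NFPoint | (∀ σ : P.F →+* ℂ, ∀ a ∈ g.aroots ℂ, r < ‖σ P.x - a‖) ∧
        (∀ ℓ ∈ S, ∀ [Fact ℓ.Prime], ∀ σ : P.F →+* PadicAlgCl ℓ, ∀ a ∈ g.aroots (PadicAlgCl ℓ),
          r < ‖σ P.x - a‖)} d ε := by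
  classical
  intro q hq0 hqP
  have hk1 : 1 ≤ k := by omega
  have he : 0 < 2 * k + 1 := by omega
  -- `ℚ̄` with the algebra structure of its construction (for the `IsAlgClosure` instance)
  letI instA : Algebra ℚ (AlgebraicClosure ℚ) := AlgebraicClosure.instAlgebra ℚ
  -- the pole polynomial of the configuration and its avoidance of the critical values
  obtain ⟨cT, hcT0, hTa, hTb⟩ :=
    ConfigurationProtection.exists_polePoly (L := AlgebraicClosure ℚ) k c hq0
  have hGA : ∀ a ∈ DeCrit.critSetC k c, aeval a cT ≠ 0 :=
    aeval_polePoly_ne_zero_of_mem_critSetC (Qb := AlgebraicClosure ℚ) hc0 hqP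
      (hroots (AlgebraicClosure ℚ)) hTb
  -- S7: the noncritical Belyi map protecting the roots of `c_T`
  obtain ⟨φ, hdeg, hnum, hden, hsub, -, hcop, -, hAcusps, hprot, -, hcount⟩ :=
    NoncriticalBelyi.exists_p1FiniteMap_noncritical_protect (DeCrit.critSetC k c)
      (fun a ha => DeCrit.isAlgebraic_of_mem_critSetC ha) cT hcT0 hGA
  -- rational forms
  have hinj : Function.Injective (Int.castRingHom ℚ) := (Int.castRingHom ℚ).injective_int
  have hpn : (φ.num.map (Int.castRingHom ℚ)).natDegree = φ.deg := by
    rw [natDegree_map_eq_of_injective hinj, hnum]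
  have hqn : (φ.den.map (Int.castRingHom ℚ)).natDegree = φ.deg := by
    rw [natDegree_map_eq_of_injective hinj, hden]
  have hpqn : (φ.num.map (Int.castRingHom ℚ) - φ.den.map (Int.castRingHom ℚ)).natDegree
      = φ.deg := by
    rw [← Polynomial.map_sub, natDegree_map_eq_of_injective hinj, hsub]
  have hp0 : φ.num.map (Int.castRingHom ℚ) ≠ 0 := fun h => by
    rw [h, natDegree_zero] at hpn; omega
  have hq0' : φ.den.map (Int.castRingHom ℚ) ≠ 0 := fun h => by
    rw [h, natDegree_zero] at hqn; omega
  have hne : φ.num.map (Int.castRingHom ℚ) ≠ φ.den.map (Int.castRingHom ℚ) := fun h => by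
    rw [h, sub_self, natDegree_zero] at hpqn; omega
  set m : ℚ[X] := φ.num.map (Int.castRingHom ℚ) * φ.den.map (Int.castRingHom ℚ) *
      (φ.num.map (Int.castRingHom ℚ) - φ.den.map (Int.castRingHom ℚ)) with hmdef
  have hmZ : m = (φ.num * φ.den * (φ.num - φ.den)).map (Int.castRingHom ℚ) := by
    rw [hmdef, Polynomial.map_mul, Polynomial.map_mul, Polynomial.map_sub]
  have hm0 : m ≠ 0 := mul_ne_zero (mul_ne_zero hp0 hq0') (sub_ne_zero.mpr hne)
  have haeZ : ∀ {T : Type} [Field T] [Algebra ℚ T] (F : ℤ[X]) (y : T),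
      aeval y (F.map (Int.castRingHom ℚ)) = aeval y F := fun F y => by
    rw [← algebraMap_int_eq, aeval_map_algebraMap]
  have hmapsZ : ∀ (T : Type) [Field T] [Algebra ℚ T],
      (φ.num * φ.den * (φ.num - φ.den)).map (Int.castRingHom T) = m.map (algebraMap ℚ T) := by
    intro T _ _
    rw [hmZ, Polynomial.map_map]
    congr 1
    exact RingHom.ext_int _ _
  -- `f g (f − g)` is coprime to `c_T` (protection), hence the bad polynomial is coprime to `q`
  have hmT : IsCoprime m cT :=
    ConfigurationProtection.isCoprime_mul_mul_sub_of_forall_root (Ω := ℂ) fun γ hγ => by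
      obtain ⟨h1, h2', h3⟩ := hprot γ hγ
      rw [haeZ, haeZ]
      exact ⟨h1, h2', h3⟩
  have hgq : IsCoprime (resultant (De.curvePoly k) (De.homFibrePolyC k c m)) q :=
    ConfigurationProtection.isCoprime_of_rootSet_eq (L := AlgebraicClosure ℚ) k c
      (De.rootSet_resultant_homFibrePolyC (Ω := AlgebraicClosure ℚ) k hc0 hm0)
      (De.resultant_homFibrePolyC_ne_zero k c hm0) hTa hmT
  refine ⟨_, hgq, fun ρ hρ => ?_⟩
  -- the field `K` of the W5 capstone: a splitting field of `R_c · f g (f − g)`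
  set fK : ℚ[X] := DeCrit.RpolyC k c * m with hfK
  have hfK0 : fK ≠ 0 := mul_ne_zero (DeCrit.RpolyC_ne_zero k c) hm0
  let K : Type := fK.SplittingField
  haveI : NumberField K := NumberField.of_module_finite ℚ K
  have hKsplit : (fK.map (algebraMap ℚ K)).Splits := SplittingField.splits fK
  have hfKK0 : fK.map (algebraMap ℚ K) ≠ 0 :=
    (Polynomial.map_ne_zero_iff (algebraMap ℚ K).injective).mpr hfK0
  have hKR : (DeCrit.RpolyC k (c : K)).Splits := by
    have h : ((DeCrit.RpolyC k c).map (algebraMap ℚ K)).Splits :=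
      hKsplit.of_dvd hfKK0 (Polynomial.map_dvd _ (dvd_mul_right _ _))
    rwa [DeCrit.map_RpolyC, eq_ratCast] at h
  have hKB : ((φ.num * φ.den * (φ.num - φ.den)).map (Int.castRingHom K)).Splits := by
    rw [hmapsZ K]
    exact hKsplit.of_dvd hfKK0 (Polynomial.map_dvd _ (dvd_mul_left _ _))
  -- the primitive integral polynomial of the field of `K ∪ B`, and the degree bound `Nd`
  obtain ⟨μ, hμmonic, hμirr, hμsplits⟩ := exists_monic_int_splits fK
  have hμdeg : (μ.map (Int.castRingHom ℚ)).natDegree ≠ 0 := hμirr.natDegree_pos.ne'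
  have hμsep : (μ.map (Int.castRingHom ℚ)).Separable := hμirr.separable
  set Nd : ℕ := (μ.map (Int.castRingHom ℚ)).natDegree * ((2 * k + 1) * d) with hNd
  -- the conductor-bound constant of the W5 capstone (w5-d045, discharged)
  obtain ⟨C₂, hC₂⟩ := exists_condBound_mechanism k hk1 hc0 φ hdeg hnum hden hsub hAcusps
    hcount.le K hKR hKB Nd hρ
  -- the log-different of the fixed layer (w5-d036, J-A)
  obtain ⟨D, -, hD⟩ := exists_logDiff_adjoin_root_le μ hμmonic hμsep
  -- the slope: `ε'` from the Riemann–Hurwitz margin `(2k−2)/(2k+1)`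
  have hk0 : (0 : ℝ) < 2 * k + 1 := by positivity
  have hk3 : (3 : ℝ) ≤ k := by exact_mod_cast hk
  have hmpos : (0 : ℝ) < ((2 * k + 1 : ℝ) - 3) / (2 * k + 1) := by
    apply div_pos <;> linarith
  have hmε : 1 / (((2 * k + 1 : ℝ) - 3) / (2 * k + 1)) < 1 + ε := by
    rw [one_div, inv_div]
    have : ((2 * k + 1 : ℕ) : ℝ) = 2 * k + 1 := by push_cast; ring
    rwa [this] at hke
  have hBc : (0 : ℝ) ≤ ((φ.deg + 2 : ℝ) * (2 * k + 4) - (6 * k + 6)) / (2 * k + 1) := by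
    apply div_nonneg _ hk0.le
    have : (1 : ℝ) ≤ φ.deg := by exact_mod_cast hdeg
    nlinarith
  obtain ⟨ε', hε'0, hslope', hε'⟩ := exists_eps_of_margin hε hmpos hmε hBc
  have hAB : (φ.deg : ℝ) * (2 * k + 4) / (2 * k + 1) -
      (1 + ε') * (((φ.deg + 2 : ℝ) * (2 * k + 4) - (6 * k + 6)) / (2 * k + 1)) =
      ((2 * k + 1 : ℝ) - 3) / (2 * k + 1) -
        ε' * (((φ.deg + 2 : ℝ) * (2 * k + 4) - (6 * k + 6)) / (2 * k + 1)) := by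
    field_simp
    ring
  have hslope : 0 < (φ.deg : ℝ) * (2 * k + 4) / (2 * k + 1) -
      (1 + ε') * (((φ.deg + 2 : ℝ) * (2 * k + 4) - (6 * k + 6)) / (2 * k + 1)) := by
    rw [hAB]; exact hslope'
  have hεfin : (1 + ε') / ((φ.deg : ℝ) * (2 * k + 4) / (2 * k + 1) -
      (1 + ε') * (((φ.deg + 2 : ℝ) * (2 * k + 4) - (6 * k + 6)) / (2 * k + 1))) ≤ 1 + ε := by
    rw [hAB]; exact hε'
  -- piece 1, at `{∞} ∪ S`
  refine vojtaIneq_mechanism_of_condBound_places k c φ (μ.map (Int.castRingHom ℚ)) hS hii hk1 hc0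
    hdeg hnum hden hsub hcop hμdeg hd hε'0 hρ _ (fun P hP => hP.1) (fun P hP => hP.2)
    (C₂ := C₂) (D := D) ?_ ?_ hslope hεfin
  · -- hκ from the W5 capstone over `L_P = F(r)(θ) ⊇ K`, 2-adic clause from `2 ∈ S`
    intro P hP hhalf haev
    have hsplitL := P.splits_mechField (2 * k + 1) (μ.map (Int.castRingHom ℚ)) hμdeg hμsplits
    have hsplitK : (fK.map (algebraMap ℚ (P.mechField (2 * k + 1)
        (μ.map (Int.castRingHom ℚ))))).Splits := hsplitL
    have hfKL0 : fK.map (algebraMap ℚ (P.mechField (2 * k + 1) (μ.map (Int.castRingHom ℚ)))) ≠ 0 :=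
      (Polynomial.map_ne_zero_iff (algebraMap ℚ _).injective).mpr hfK0
    have hsplitm : (m.map (algebraMap ℚ (P.mechField (2 * k + 1)
        (μ.map (Int.castRingHom ℚ))))).Splits :=
      hsplitL.of_dvd hfKL0 (Polynomial.map_dvd _ (dvd_mul_left _ _))
    let ιK : K →ₐ[ℚ] P.mechField (2 * k + 1) (μ.map (Int.castRingHom ℚ)) :=
      SplittingField.lift fK hsplitK
    letI : Algebra K (P.mechField (2 * k + 1) (μ.map (Int.castRingHom ℚ))) :=
      ιK.toRingHom.toAlgebra
    have hPU : P.InU := hP.2.1.1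
    have hxU := (P.inU_mechPoint_iff (2 * k + 1) (μ.map (Int.castRingHom ℚ))).mpr hPU
    have hr := P.mechRoot_ne_zero (2 * k + 1) (μ.map (Int.castRingHom ℚ)) hPU he
    have hs := (P.one_sub_two_mul_mechPoint_x_ne_zero_iff (2 * k + 1)
      (μ.map (Int.castRingHom ℚ))).mpr hhalf
    have hcurve := P.mechRoot_pow (2 * k + 1) (μ.map (Int.castRingHom ℚ)) he
    have hsplitZ : ((φ.num * φ.den * (φ.num - φ.den)).map
        (Int.castRingHom (P.mechField (2 * k + 1) (μ.map (Int.castRingHom ℚ))))).Splits := by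
      rw [hmapsZ]
      exact hsplitm
    have hdegL : Module.finrank ℚ (P.mechField (2 * k + 1) (μ.map (Int.castRingHom ℚ))) ≤ Nd :=
      P.degree_mechPoint_le_of_le (2 * k + 1) (μ.map (Int.castRingHom ℚ)) he hμdeg hP.2.2 le_rfl
    haveI : Fact (Nat.Prime 2) := ⟨Nat.prime_two⟩
    have key := hC₂ (P.mechField (2 * k + 1) (μ.map (Int.castRingHom ℚ))) hdegL
      (P.mechPoint (2 * k + 1) (μ.map (Int.castRingHom ℚ))).x
      (P.mechRoot (2 * k + 1) (μ.map (Int.castRingHom ℚ))) hcurve hxU.1 hxU.2 hr hs hsplitZ haev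
      (fun σ a ha => hP.1.1
        (σ.comp (algebraMap P.F (P.mechField (2 * k + 1) (μ.map (Int.castRingHom ℚ))))) a ha)
      (fun σ a ha => hP.1.2 2 h2S
        (σ.comp (algebraMap P.F (P.mechField (2 * k + 1) (μ.map (Int.castRingHom ℚ))))) a ha)
    have hht : (⟨P.mechField (2 * k + 1) (μ.map (Int.castRingHom ℚ)),
        (P.mechPoint (2 * k + 1) (μ.map (Int.castRingHom ℚ))).x⟩ : NFPoint).ht = P.ht :=
      P.ht_mechPoint (2 * k + 1) (μ.map (Int.castRingHom ℚ))
    rw [hht] at key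
    exact key
  · -- hD from J-A at `θ := P.mechTheta`
    intro P hP _
    refine hD (P.dePoint (2 * k + 1)) (P.mechPoint (2 * k + 1) (μ.map (Int.castRingHom ℚ)))
      (P.mechTheta (2 * k + 1) (μ.map (Int.castRingHom ℚ))) ?_
      (P.adjoin_mechTheta (2 * k + 1) (μ.map (Int.castRingHom ℚ)))
    rw [← haeZ]
    exact P.aeval_mechTheta (2 * k + 1) (μ.map (Int.castRingHom ℚ)) hμdeg

end Literature.NumberTheory.DiophantineGeometry.GenEll

end
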